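import Summits.BirchSwinnertonDyer.BirchSwinnertonDyer.Theorems.PrintCf2SplitBadTwoLocalDefectTrivialEval
import Summits.BirchSwinnertonDyer.BirchSwinnertonDyer.Theorems.PrintCf2SplitBadTwoLineDecompVbarTrivialEvenSeven
import Summits.BirchSwinnertonDyer.BirchSwinnertonDyer.Theorems.PrintCf2SplitBadTwoLocalControlKernelDyadicEven
import HarnessLib

/-!
# Crux `PrintCf2.SplitBadTwoRankOneOfFacts` (stmt-BirchSwinnertonDyer-20368), skeleton v13.1, stub S3d `stub_strictDefectAtVbar_two`, class (iii) —
# file D2 (road-α frames): the local defect group `𝓛` above `v̄` IS `W*` — evaluation at a degree-one element of `D″` is an equivariant bijection `𝓛 → W*`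

Cell `bsd-print-cf2`, width seat `bsd-line-cf2-p1-w6` g5 (S3d: «𝓗 local + ch(𝓗^∨)(0) per class»); `--supports stmt-BirchSwinnertonDyer-20368 --as helper`.
HONEST FRAMING: nothing here closes the crux or a registered stub; no summit statement is proved by this seat; BSD is not proved by any of this.
No definition, no named fact, no `sorry`.

Frame: member `C • W = cm7^{(d)}` (`d ≠ 0`), `K` imaginary quadratic, `2 = v v̄`, `W* = ↥((W.baseChange K).endEigenPrimaryTorsion 2 π r)` pinned at `v`, `κ'` the
`ℤ₂`-line unramified outside `v̄`, `D″ := Coinv.kerD κ' v̄`, `ρ` = the restriction `H¹(D″, W*) → H¹(ker κ' ⊓ I_v̄, W*)` along `Coinv.toKerD` (-w4 g11's currency),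
`𝓛 := {a | ρ a = 0}`.
* **`exists_isFrobPow_one_mem_kerSubgroup_of_frame`** (EVERY frame): there is a degree-one `σ₀ ∈ Γ_{K_v̄}` (`IsFrobPow σ₀ 1`) with `res σ₀ ∈ ker κ'` — the product
  `φ·τ` of a Frobenius lift and the inertia element with `ε(τ) = α·ε(φ)⁻¹` has `ε = α`, so it acts on every `W*[2^k]` as `χ_d·α·α⁻¹ = χ_d = ±1`, hence lies in
  `ker κ'` by (C3) (the element of B15 file 11 `…_even_three`, now for every class); `exists_kerD_eq_absGaloisRestrict_of_frame` packages `φ₀ := res σ₀ ∈ D″`.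
* `smul_eq_self_kerD_of_frame_classThree` — (T0) in `Coinv.kerD` currency: on class (iii) (`d ≡ 3 (8) ∨ d ≡ 14 (16)`) `D″` acts trivially on `W*` (file C p694089).
* `isTorsion_endEigenPrimaryTorsion` — `W*` is a torsion group.
* **`eq_zero_of_evalH1_eq_zero_of_frame_classThree`** (T1), **`exists_evalH1_eq_of_frame_classThree`** (T2), **`evalH1_conjH1_eq_smul_of_frame_classThree`** (T3),
  `resH1Hom_toKerD_conjH1_eq_zero_of_frame_classThree` — file D1's generic evaluation structure instantiated: on class (iii), for any degree-one `σ₀` with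
  `res σ₀ = φ₀ ∈ D″`, evaluation at `φ₀` is a BIJECTION `𝓛 → W*` intertwining `conj_δ` (`δ ∈ D_v̄`) with `δ • ·`. Consumers: -w3 g12's receptacle `H := W*`
  (j := eval ∘ (DC-6)), -w4 g11's h𝓛, -w8 g4's (DC-6).

presearch: Greenberg–Vatsal 2000 §2 pp. 17–21 (local term `Hom(Gal(K^{nr}_{∞,η}/K_{∞,η}), A)` of the non-primitive Selmer group); Rubin LNM 1716 §3 Cor. 3.17; Serre,
Local Fields XIII §1 — held; tree assembly, no new fact. beyond-print theorem: no.

References: [GreenbergVatsal2000] §2 pp. 17–21; [Rubin1999] §3 Lemma 3.6 (ii), Cor. 3.17; [Agboola2007] §3 Prop. 3.2; [SerreLocalFields1979] XIII §1 Prop. 1;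
[NeukirchSchmidtWingberg2008] Thm. 7.5.3.
-/

noncomputable section

open scoped Classical

set_option linter.dupNamespace false
set_option autoImplicit false

open NumberField IsDedekindDomain Field WeierstrassCurve
open Literature.NumberTheory.EllipticCurves Literature.NumberTheory.EllipticCurves.GreenbergSelmer
open Literature.NumberTheory.GaloisRepresentations
open Summit.BirchSwinnertonDyer.Rank1Residual.X11b
open Summit.BirchSwinnertonDyer.BirchSwinnertonDyer.Theorems.PrintCf2.AdditiveAtSeven
open Summit.BirchSwinnertonDyer.BirchSwinnertonDyer.Theorems.PrintCf2.CMPrimes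
open Summit.BirchSwinnertonDyer.BirchSwinnertonDyer.Theorems.PrintCf2.RestrictedSelmerPair
open Summit.BirchSwinnertonDyer.BirchSwinnertonDyer.Theorems.PrintCf2.UnrBaseLift

namespace Summit.BirchSwinnertonDyer.BirchSwinnertonDyer.Theorems.PrintCf2.LocalDefectTrivial

variable {K : Type} [Field K] [NumberField K]

/-! ## §1. A degree-one element of `Γ_{K_v̄}` restricting into `ker κ'` (every frame) -/

/-- **On every road-α frame some degree-one `σ₀ ∈ Γ_{K_v̄}` restricts into `ker κ'`.** With `φ` of Frobenius degree one and `τ ∈ I(K̄_v̄/K_v̄)` the inertia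
element with `ε(τ) = α·ε(φ)⁻¹` (`ZpExtension.exists_mem_inertia_cyclotomicCharacter_eq_of_split`), `σ₀ := φ·τ` has degree one and `ε(res σ₀) = α`; by the named
local type it acts on every `W*[2^k]` as `χ_d(σ₀)·α·α⁻¹ = χ_d(σ₀) = ±1`, so on all of `W*` as `+1` or as `−1`, i.e. `res σ₀ ∈ ker κ'` by (C3)
`mem_kerSubgroup_iff_smul_of_frame`. [cite: Rubin1999, §3 Lemma 3.6 (ii) and Cor. 3.17] [cite: SerreAbelianLadic1968, Ch. I §1.2] -/
theorem exists_isFrobPow_one_mem_kerSubgroup_of_frame {d : ℤ} (hd0 : d ≠ 0)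
    (W : WeierstrassCurve ℚ) [W.IsElliptic] (C : VariableChange ℚ) (hC : C • W = cm7.quadraticTwist (d : ℚ)) (hK : IsImaginaryQuadratic K)
    (v vbar : HeightOneSpectrum (𝓞 K)) (hv : ((2 : ℕ) : 𝓞 K) ∈ v.asIdeal) (hvbar : ((2 : ℕ) : 𝓞 K) ∈ vbar.asIdeal) (hne : vbar ≠ v)
    (π : (W.baseChange K).endRing) (hrel : (π : AddMonoid.End (W.baseChange K).geomPoints) * π = π - 2) {r : ℤ_[2]} (hr : r * r = r - 2)
    (hpin : ∀ τ ∈ GreenbergSelmer.inertia v, ∀ x : ↥((W.baseChange K).endEigenPrimaryTorsion 2 π r), τ • x = x ∨ τ • x = -x)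
    (κ' : ZpExtension K 2) (hκ' : κ'.IsUnramifiedOutside vbar) :
    ∃ σ₀ : absoluteGaloisGroup (vbar.adicCompletion K), IsFrobPow σ₀ 1 ∧ absGaloisRestrict K (vbar.adicCompletion K) σ₀ ∈ κ'.kerSubgroup := by
  haveI : Fact (Nat.Prime 2) := ⟨Nat.prime_two⟩
  have hj : W.j = -3375 := j_eq_of_smul_eq_cm7Twist hd0 W C hC
  obtain ⟨θ, hθ⟩ := exists_sq_eq_neg_seven_of_cmEndo_mem_endRing W K hj π hrel
  have hK2 : Module.finrank ℚ K = 2 := hK.1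
  -- the kernel-type clause (R) at `v̄` for `E[𝔮_r^∞]` and the named local type
  obtain ⟨hcl', -⟩ := endEigenPrimaryTorsion_two_pinningClause_swap W K hj hK hθ π hrel hr hv hvbar hne hpin
  have hcl'' : ∀ τ ∈ GreenbergSelmer.inertia vbar, ∀ y ∈ (W.baseChange K).endEigenPrimaryTorsion 2 π (1 - r),
      τ • y = y ∨ τ • y = -y := fun τ hτ y hy ↦ by
    rcases hcl' τ hτ ⟨y, hy⟩ with h | h
    · exact Or.inl (congrArg Subtype.val h)
    · exact Or.inr (congrArg Subtype.val h)
  have h1r : (1 - r) * (1 - r) = (1 - r) - 2 := by linear_combination hr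
  have hdQ : (d : ℚ) ≠ 0 := by exact_mod_cast hd0
  obtain ⟨α, -, -, hUR⟩ := endEigenPrimaryTorsion_two_localTypes_named_of_pinned W K hj hθ π hrel h1r hdQ C hC vbar hvbar
    (inertiaDeg_eq_one_of_ne_two K hK2 hvbar hv hne.symm) hcl''
  simp only [sub_sub_cancel] at hUR
  have HR := fun σ n hσ s hs ↦ (hUR σ n hσ s hs).2
  -- `φ` of degree one and the inertia partner `τ` with `ε(τ) = α·ε(φ)⁻¹`
  obtain ⟨φ, hφ1⟩ := exists_isFrobPow_holds (F := vbar.adicCompletion K) 1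
  set εφ : ℤ_[2]ˣ := GaloisRep.cyclotomicCharacter K 2 (absGaloisRestrict K (vbar.adicCompletion K) φ) with hεφ
  obtain ⟨τ, hτI, hτχ⟩ := ZpExtension.exists_mem_inertia_cyclotomicCharacter_eq_of_split hK2 hv hvbar hne
    (adicCompletionPrime_mem_primesAbove K vbar) (α * εφ⁻¹)
  rw [inertia_adicCompletionPrime_eq_map_absInertia K vbar, Subgroup.mem_map] at hτI
  obtain ⟨στ, hστI, hσττ⟩ := hτI
  have hτχ' : GaloisRep.cyclotomicCharacter K 2 (absGaloisRestrict K (vbar.adicCompletion K) στ) = α * εφ⁻¹ := by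
    rw [← hτχ]; exact congrArg _ hσττ
  have hεσ : GaloisRep.cyclotomicCharacter K 2 (absGaloisRestrict K (vbar.adicCompletion K) (φ * στ)) = α := by
    rw [map_mul, map_mul, hτχ', ← hεφ, mul_comm, inv_mul_cancel_right]
  have hσ1 : IsFrobPow (φ * στ) ((1 : ℕ) : ℤ) := by
    have h := IsFrobPow.mul_holds hφ1 (isFrobPow_zero_iff_mem_absInertia.mpr hστI)
    rw [add_zero] at h
    exact_mod_cast h
  have hαinv : (α : ℤ_[2]) * ((α⁻¹ : ℤ_[2]ˣ) : ℤ_[2]) = 1 := by rw [← Units.val_mul, mul_inv_cancel, Units.val_one]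
  -- the sign `s` of `σ₀ = φ·τ` on `ι√d`
  obtain ⟨s, hs, hs1⟩ : ∃ s : ℤ, ((absGaloisRestrict K (vbar.adicCompletion K) (φ * στ) • absClosureEmbedding ℚ K (WeierstrassCurve.geomSqrt (d : ℚ)) =
        absClosureEmbedding ℚ K (WeierstrassCurve.geomSqrt (d : ℚ)) ∧ s = 1) ∨
      (absGaloisRestrict K (vbar.adicCompletion K) (φ * στ) • absClosureEmbedding ℚ K (WeierstrassCurve.geomSqrt (d : ℚ)) =
        -absClosureEmbedding ℚ K (WeierstrassCurve.geomSqrt (d : ℚ)) ∧ s = -1)) ∧ (s = 1 ∨ s = -1) := by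
    rcases smul_absClosureEmbedding_geomSqrt_eq_or K (d : ℚ) (absGaloisRestrict K (vbar.adicCompletion K) (φ * στ)) with hA | hA
    · exact ⟨1, Or.inl ⟨hA, rfl⟩, Or.inl rfl⟩
    · exact ⟨-1, Or.inr ⟨hA, rfl⟩, Or.inr rfl⟩
  -- `σ₀` acts on all of `W*` as `s`
  have hact : ∀ x : ↥((W.baseChange K).endEigenPrimaryTorsion 2 π r), absGaloisRestrict K (vbar.adicCompletion K) (φ * στ) • x = s • x := by
    intro x
    obtain ⟨k, hk⟩ := (AddCommGroup.mem_primaryComponent).mp (x : (W.baseChange K).geomPrimaryTorsion 2).2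
    have hxk : 2 ^ k • (x : (W.baseChange K).geomPrimaryTorsion 2) = 0 :=
      Subtype.ext (by rw [AddSubmonoidClass.coe_nsmul, ZeroMemClass.coe_zero]; exact hk)
    have hmem : (((s : ℤ) : ℤ_[2]) - (s : ℤ) * ((GaloisRep.cyclotomicCharacter K 2 (absGaloisRestrict K (vbar.adicCompletion K) (φ * στ)) *
        (α⁻¹) ^ 1 : ℤ_[2]ˣ) : ℤ_[2])) ∈ (Ideal.span {(2 : ℤ_[2]) ^ k} : Ideal ℤ_[2]) := by
      rw [hεσ, pow_one, Units.val_mul, hαinv, mul_one, sub_self]; exact Ideal.zero_mem _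
    have h := HR (φ * στ) 1 hσ1 s hs k x x.2 hxk s hmem
    exact Subtype.ext (by rw [AddSubgroupClass.coe_zsmul]; exact h)
  refine ⟨φ * στ, by exact_mod_cast hσ1, (mem_kerSubgroup_iff_smul_of_frame hd0 W C hC hK v vbar hv hvbar hne π hrel hr hpin κ' hκ' _).mpr ?_⟩
  rcases hs1 with rfl | rfl
  · exact Or.inl fun x ↦ by rw [hact x, one_zsmul]
  · exact Or.inr fun x ↦ by rw [hact x, neg_one_zsmul]

/-- **`φ₀ := res σ₀ ∈ D″ = Coinv.kerD κ' v̄`** for the degree-one `σ₀` above (packaged for files D1/D2's hypotheses `hσ₀`, `hφ₀`). [folklore] -/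
theorem exists_kerD_eq_absGaloisRestrict_of_frame {d : ℤ} (hd0 : d ≠ 0)
    (W : WeierstrassCurve ℚ) [W.IsElliptic] (C : VariableChange ℚ) (hC : C • W = cm7.quadraticTwist (d : ℚ)) (hK : IsImaginaryQuadratic K)
    (v vbar : HeightOneSpectrum (𝓞 K)) (hv : ((2 : ℕ) : 𝓞 K) ∈ v.asIdeal) (hvbar : ((2 : ℕ) : 𝓞 K) ∈ vbar.asIdeal) (hne : vbar ≠ v)
    (π : (W.baseChange K).endRing) (hrel : (π : AddMonoid.End (W.baseChange K).geomPoints) * π = π - 2) {r : ℤ_[2]} (hr : r * r = r - 2)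
    (hpin : ∀ τ ∈ GreenbergSelmer.inertia v, ∀ x : ↥((W.baseChange K).endEigenPrimaryTorsion 2 π r), τ • x = x ∨ τ • x = -x)
    (κ' : ZpExtension K 2) (hκ' : κ'.IsUnramifiedOutside vbar) :
    ∃ (σ₀ : absoluteGaloisGroup (vbar.adicCompletion K)) (φ₀ : ↥(Coinv.kerD κ' vbar)), IsFrobPow σ₀ 1 ∧
      ((φ₀ : ↥(decomp vbar)) : absoluteGaloisGroup K) = absGaloisRestrict K (vbar.adicCompletion K) σ₀ := by
  obtain ⟨σ₀, hσ₀, hκ⟩ := exists_isFrobPow_one_mem_kerSubgroup_of_frame hd0 W C hC hK v vbar hv hvbar hne π hrel hr hpin κ' hκ'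
  exact ⟨σ₀, ⟨⟨absGaloisRestrict K (vbar.adicCompletion K) σ₀, (mem_decomp_iff vbar _).mpr ⟨σ₀, rfl⟩⟩, (Coinv.mem_kerD_iff κ' vbar _).mpr hκ⟩,
    hσ₀, rfl⟩

/-! ## §2. Class (iii): `D″` acts trivially (in `Coinv.kerD` currency) and `W*` is torsion -/

/-- **(T0) in `Coinv.kerD` currency**: on class (iii) (`d ≡ 3 (mod 8)` or `d ≡ 14 (mod 16)`) every element of `D″ = Coinv.kerD κ' v̄` fixes every point of `W*`
(file C `smul_eq_self_of_mem_decomp_vbar_inf_kerSubgroup_of_frame_classThree`, p694089). [cite: Rubin1999, §3 Cor. 3.17] [cite: Agboola2007, §3 Prop. 3.2] -/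
theorem smul_eq_self_kerD_of_frame_classThree {d : ℤ} (hd0 : d ≠ 0) (hcl : d % 8 = 3 ∨ ((2 : ℤ) ∣ d ∧ (d / 2) % 8 = 7))
    (W : WeierstrassCurve ℚ) [W.IsElliptic] (C : VariableChange ℚ) (hC : C • W = cm7.quadraticTwist (d : ℚ)) (hK : IsImaginaryQuadratic K)
    (v vbar : HeightOneSpectrum (𝓞 K)) (hv : ((2 : ℕ) : 𝓞 K) ∈ v.asIdeal) (hvbar : ((2 : ℕ) : 𝓞 K) ∈ vbar.asIdeal) (hne : vbar ≠ v)
    (π : (W.baseChange K).endRing) (hrel : (π : AddMonoid.End (W.baseChange K).geomPoints) * π = π - 2) {r : ℤ_[2]} (hr : r * r = r - 2)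
    (hpin : ∀ τ ∈ GreenbergSelmer.inertia v, ∀ x : ↥((W.baseChange K).endEigenPrimaryTorsion 2 π r), τ • x = x ∨ τ • x = -x)
    (κ' : ZpExtension K 2) (hκ' : κ'.IsUnramifiedOutside vbar)
    (n : ↥(Coinv.kerD κ' vbar)) (m : ↥((W.baseChange K).endEigenPrimaryTorsion 2 π r)) : n • m = m :=
  smul_eq_self_of_mem_decomp_vbar_inf_kerSubgroup_of_frame_classThree hd0 hcl W C hC hK v vbar hv hvbar hne π hrel hr hpin κ' hκ'
    (n : ↥(decomp vbar)).2 ((Coinv.mem_kerD_iff κ' vbar _).mp n.2) m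

/-- `W*` is a torsion group (`2`-primary). [folklore] -/
theorem isTorsion_endEigenPrimaryTorsion (W : WeierstrassCurve ℚ) [W.IsElliptic] (π : (W.baseChange K).endRing) (r : ℤ_[2]) :
    AddMonoid.IsTorsion ↥((W.baseChange K).endEigenPrimaryTorsion 2 π r) := by
  haveI : Fact (Nat.Prime 2) := ⟨Nat.prime_two⟩
  intro m
  obtain ⟨k, hk⟩ := exists_pow_smul_endEigenPrimaryTorsion_eq_zero (W.baseChange K) 2 π r m
  exact isOfFinAddOrder_iff_nsmul_eq_zero.mpr ⟨2 ^ k, pow_pos two_pos k, hk⟩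

/-! ## §3. Class (iii): evaluation at `φ₀` is an equivariant bijection `𝓛 → W*` -/

/-- **(T1) on class (iii) — INJECTIVITY**: a class `a ∈ 𝓛 ≤ H¹(D″, W*)` with `eval_{φ₀}(a) = 0` is `0`, for any degree-one `σ₀` with `res σ₀ = φ₀ ∈ D″`
(file D1 `eq_zero_of_evalH1_eq_zero` with (T0)). [cite: GreenbergVatsal2000, §2 p. 17] [cite: SerreGaloisCohomology1997, I §2.3] -/
theorem eq_zero_of_evalH1_eq_zero_of_frame_classThree {d : ℤ} (hd0 : d ≠ 0) (hcl : d % 8 = 3 ∨ ((2 : ℤ) ∣ d ∧ (d / 2) % 8 = 7))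
    (W : WeierstrassCurve ℚ) [W.IsElliptic] (C : VariableChange ℚ) (hC : C • W = cm7.quadraticTwist (d : ℚ)) (hK : IsImaginaryQuadratic K)
    (v vbar : HeightOneSpectrum (𝓞 K)) (hv : ((2 : ℕ) : 𝓞 K) ∈ v.asIdeal) (hvbar : ((2 : ℕ) : 𝓞 K) ∈ vbar.asIdeal) (hne : vbar ≠ v)
    (π : (W.baseChange K).endRing) (hrel : (π : AddMonoid.End (W.baseChange K).geomPoints) * π = π - 2) {r : ℤ_[2]} (hr : r * r = r - 2)
    (hpin : ∀ τ ∈ GreenbergSelmer.inertia v, ∀ x : ↥((W.baseChange K).endEigenPrimaryTorsion 2 π r), τ • x = x ∨ τ • x = -x)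
    (κ' : ZpExtension K 2) (hκ' : κ'.IsUnramifiedOutside vbar)
    {σ₀ : absoluteGaloisGroup (vbar.adicCompletion K)} (hσ₀ : IsFrobPow σ₀ 1)
    {φ₀ : ↥(Coinv.kerD κ' vbar)} (hφ₀ : ((φ₀ : ↥(decomp vbar)) : absoluteGaloisGroup K) = absGaloisRestrict K (vbar.adicCompletion K) σ₀)
    {a : subgroupH1 (Coinv.kerD κ' vbar) ↥((W.baseChange K).endEigenPrimaryTorsion 2 π r)}
    (ha : resH1Hom (Coinv.toKerD κ' vbar (kerSubgroup_inf_inertia_le_decomp κ' vbar) (inf_le_left : κ'.kerSubgroup ⊓ inertia vbar ≤ κ'.kerSubgroup))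
        (AddMonoidHom.id ↥((W.baseChange K).endEigenPrimaryTorsion 2 π r)) (fun _ _ ↦ rfl) a = 0)
    (h0 : evalH1 (smul_eq_self_kerD_of_frame_classThree hd0 hcl W C hC hK v vbar hv hvbar hne π hrel hr hpin κ' hκ') φ₀ a = 0) : a = 0 :=
  eq_zero_of_evalH1_eq_zero κ' vbar _ hσ₀ hφ₀ ha h0

/-- **(T2) on class (iii) — SURJECTIVITY**: every `m ∈ W*` is `eval_{φ₀}(a)` for some `a ∈ 𝓛` (file D1 `exists_evalH1_eq` with (T0) and torsion).
[cite: GreenbergVatsal2000, §2 p. 17] [cite: SerreLocalFields1979, XIII §1 Prop. 1] -/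
theorem exists_evalH1_eq_of_frame_classThree {d : ℤ} (hd0 : d ≠ 0) (hcl : d % 8 = 3 ∨ ((2 : ℤ) ∣ d ∧ (d / 2) % 8 = 7))
    (W : WeierstrassCurve ℚ) [W.IsElliptic] (C : VariableChange ℚ) (hC : C • W = cm7.quadraticTwist (d : ℚ)) (hK : IsImaginaryQuadratic K)
    (v vbar : HeightOneSpectrum (𝓞 K)) (hv : ((2 : ℕ) : 𝓞 K) ∈ v.asIdeal) (hvbar : ((2 : ℕ) : 𝓞 K) ∈ vbar.asIdeal) (hne : vbar ≠ v)
    (π : (W.baseChange K).endRing) (hrel : (π : AddMonoid.End (W.baseChange K).geomPoints) * π = π - 2) {r : ℤ_[2]} (hr : r * r = r - 2)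
    (hpin : ∀ τ ∈ GreenbergSelmer.inertia v, ∀ x : ↥((W.baseChange K).endEigenPrimaryTorsion 2 π r), τ • x = x ∨ τ • x = -x)
    (κ' : ZpExtension K 2) (hκ' : κ'.IsUnramifiedOutside vbar)
    {σ₀ : absoluteGaloisGroup (vbar.adicCompletion K)} (hσ₀ : IsFrobPow σ₀ 1)
    {φ₀ : ↥(Coinv.kerD κ' vbar)} (hφ₀ : ((φ₀ : ↥(decomp vbar)) : absoluteGaloisGroup K) = absGaloisRestrict K (vbar.adicCompletion K) σ₀)
    (m : ↥((W.baseChange K).endEigenPrimaryTorsion 2 π r)) :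
    ∃ a : subgroupH1 (Coinv.kerD κ' vbar) ↥((W.baseChange K).endEigenPrimaryTorsion 2 π r),
      resH1Hom (Coinv.toKerD κ' vbar (kerSubgroup_inf_inertia_le_decomp κ' vbar) (inf_le_left : κ'.kerSubgroup ⊓ inertia vbar ≤ κ'.kerSubgroup))
          (AddMonoidHom.id ↥((W.baseChange K).endEigenPrimaryTorsion 2 π r)) (fun _ _ ↦ rfl) a = 0 ∧
      evalH1 (smul_eq_self_kerD_of_frame_classThree hd0 hcl W C hC hK v vbar hv hvbar hne π hrel hr hpin κ' hκ') φ₀ a = m :=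
  exists_evalH1_eq κ' vbar _ (isTorsion_endEigenPrimaryTorsion W π r) hσ₀ hφ₀ m

/-- **`𝓛` is `D_v̄`-stable** on class (iii) (file D1 `resH1Hom_toKerD_conjH1_eq_zero`). [cite: SerreGaloisCohomology1997, I §2.5] -/
theorem resH1Hom_toKerD_conjH1_eq_zero_of_frame_classThree {d : ℤ} (hd0 : d ≠ 0) (hcl : d % 8 = 3 ∨ ((2 : ℤ) ∣ d ∧ (d / 2) % 8 = 7))
    (W : WeierstrassCurve ℚ) [W.IsElliptic] (C : VariableChange ℚ) (hC : C • W = cm7.quadraticTwist (d : ℚ)) (hK : IsImaginaryQuadratic K)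
    (v vbar : HeightOneSpectrum (𝓞 K)) (hv : ((2 : ℕ) : 𝓞 K) ∈ v.asIdeal) (hvbar : ((2 : ℕ) : 𝓞 K) ∈ vbar.asIdeal) (hne : vbar ≠ v)
    (π : (W.baseChange K).endRing) (hrel : (π : AddMonoid.End (W.baseChange K).geomPoints) * π = π - 2) {r : ℤ_[2]} (hr : r * r = r - 2)
    (hpin : ∀ τ ∈ GreenbergSelmer.inertia v, ∀ x : ↥((W.baseChange K).endEigenPrimaryTorsion 2 π r), τ • x = x ∨ τ • x = -x)
    (κ' : ZpExtension K 2) (hκ' : κ'.IsUnramifiedOutside vbar) (δ : ↥(decomp vbar))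
    {a : subgroupH1 (Coinv.kerD κ' vbar) ↥((W.baseChange K).endEigenPrimaryTorsion 2 π r)}
    (ha : resH1Hom (Coinv.toKerD κ' vbar (kerSubgroup_inf_inertia_le_decomp κ' vbar) (inf_le_left : κ'.kerSubgroup ⊓ inertia vbar ≤ κ'.kerSubgroup))
        (AddMonoidHom.id ↥((W.baseChange K).endEigenPrimaryTorsion 2 π r)) (fun _ _ ↦ rfl) a = 0) :
    resH1Hom (Coinv.toKerD κ' vbar (kerSubgroup_inf_inertia_le_decomp κ' vbar) (inf_le_left : κ'.kerSubgroup ⊓ inertia vbar ≤ κ'.kerSubgroup))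
        (AddMonoidHom.id ↥((W.baseChange K).endEigenPrimaryTorsion 2 π r)) (fun _ _ ↦ rfl)
        (conjH1 (Coinv.kerD κ' vbar) ↥((W.baseChange K).endEigenPrimaryTorsion 2 π r) δ a) = 0 :=
  resH1Hom_toKerD_conjH1_eq_zero κ' vbar (smul_eq_self_kerD_of_frame_classThree hd0 hcl W C hC hK v vbar hv hvbar hne π hrel hr hpin κ' hκ') δ ha

/-- **(T3) on class (iii) — EQUIVARIANCE**: `eval_{φ₀}(conj_δ a) = δ • eval_{φ₀}(a)` for `δ ∈ D_v̄`, `a ∈ 𝓛` (file D1 `evalH1_conjH1_eq_smul`): `δ` acts on `𝓛 ≅ W*`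
through its scalar on `W*` (`ψ_{W*}(δ)`). [cite: SerreGaloisCohomology1997, I §2.5] [cite: GreenbergVatsal2000, §2 pp. 17–21] -/
theorem evalH1_conjH1_eq_smul_of_frame_classThree {d : ℤ} (hd0 : d ≠ 0) (hcl : d % 8 = 3 ∨ ((2 : ℤ) ∣ d ∧ (d / 2) % 8 = 7))
    (W : WeierstrassCurve ℚ) [W.IsElliptic] (C : VariableChange ℚ) (hC : C • W = cm7.quadraticTwist (d : ℚ)) (hK : IsImaginaryQuadratic K)
    (v vbar : HeightOneSpectrum (𝓞 K)) (hv : ((2 : ℕ) : 𝓞 K) ∈ v.asIdeal) (hvbar : ((2 : ℕ) : 𝓞 K) ∈ vbar.asIdeal) (hne : vbar ≠ v)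
    (π : (W.baseChange K).endRing) (hrel : (π : AddMonoid.End (W.baseChange K).geomPoints) * π = π - 2) {r : ℤ_[2]} (hr : r * r = r - 2)
    (hpin : ∀ τ ∈ GreenbergSelmer.inertia v, ∀ x : ↥((W.baseChange K).endEigenPrimaryTorsion 2 π r), τ • x = x ∨ τ • x = -x)
    (κ' : ZpExtension K 2) (hκ' : κ'.IsUnramifiedOutside vbar)
    {σ₀ : absoluteGaloisGroup (vbar.adicCompletion K)}
    {φ₀ : ↥(Coinv.kerD κ' vbar)} (hφ₀ : ((φ₀ : ↥(decomp vbar)) : absoluteGaloisGroup K) = absGaloisRestrict K (vbar.adicCompletion K) σ₀)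
    (δ : ↥(decomp vbar)) {a : subgroupH1 (Coinv.kerD κ' vbar) ↥((W.baseChange K).endEigenPrimaryTorsion 2 π r)}
    (ha : resH1Hom (Coinv.toKerD κ' vbar (kerSubgroup_inf_inertia_le_decomp κ' vbar) (inf_le_left : κ'.kerSubgroup ⊓ inertia vbar ≤ κ'.kerSubgroup))
        (AddMonoidHom.id ↥((W.baseChange K).endEigenPrimaryTorsion 2 π r)) (fun _ _ ↦ rfl) a = 0) :
    evalH1 (smul_eq_self_kerD_of_frame_classThree hd0 hcl W C hC hK v vbar hv hvbar hne π hrel hr hpin κ' hκ') φ₀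
        (conjH1 (Coinv.kerD κ' vbar) ↥((W.baseChange K).endEigenPrimaryTorsion 2 π r) δ a) =
      (δ : absoluteGaloisGroup K) • evalH1 (smul_eq_self_kerD_of_frame_classThree hd0 hcl W C hC hK v vbar hv hvbar hne π hrel hr hpin κ' hκ') φ₀ a :=
  evalH1_conjH1_eq_smul κ' vbar _ hφ₀ δ ha

end Summit.BirchSwinnertonDyer.BirchSwinnertonDyer.Theorems.PrintCf2.LocalDefectTrivial

end
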